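import Literature.NumberTheory.Transcendental.TaylorCoeffsAlgebraicOfRelation
import Mathlib.Analysis.SpecialFunctions.ExpDeriv
import HarnessLib

/-!
# Taylor coefficients of a logarithm `ℓ` with `e^ℓ` algebraic over `ℂ(t⁻ᵉ)` are algebraic

Companion of `TaylorCoeffsAlgebraicOfRelation`. Let `ℓ` be analytic at `0`, `e ≥ 1`, and let
`R ∈ ℂ[X, Y]` be nonzero with algebraic coefficients such that the UNIT `Ψ = e^{ℓ}` satisfies
`R(t⁻ᵉ, e^{ℓ(t)}) = 0` on a punctured neighbourhood of `0`. Then `e^{ℓ(0)}` is algebraic and all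
Taylor coefficients `ℓ⁽ⁿ⁾(0)`, `n ≥ 1`, are algebraic over `ℚ`
(`isAlgebraic_exp_and_iteratedDeriv_of_mvPolynomial_exp_relation`): all `Ψ⁽ᵏ⁾(0)` are algebraic
by `isAlgebraic_iteratedDeriv_of_mvPolynomial_relation` (with `N = 0`); the jets with algebraic
entries are closed under products (Leibniz, `isAlgebraic_iteratedDeriv_mul`) and under inversion
of a unit (`isAlgebraic_iteratedDeriv_inv`, from `(1/Ψ)' = -Ψ'·(1/Ψ)²`); finally `ℓ' = Ψ'·(1/Ψ)`
near `0`. This is the multiplicative half of the arithmetic normal form of a cusp of a `ℚ`-curve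
(crux `RigidCore.SparsityTwo`, line cusp-germ-schneider-sparsity). [folklore]
-/

noncomputable section

open Filter Polynomial
open _root_.Topology

namespace Literature.NumberTheory.Transcendental

/-- **Leibniz closure.** If `f, g` are `Cⁿ` at `x` and the derivatives `f⁽ᵏ⁾(x)`, `g⁽ᵏ⁾(x)`,
`k ≤ n`, are algebraic over `ℚ`, then so is `(fg)⁽ⁿ⁾(x)`. [folklore] -/
theorem isAlgebraic_iteratedDeriv_mul {f g : ℂ → ℂ} {x : ℂ} {n : ℕ} (hf : ContDiffAt ℂ n f x)
    (hg : ContDiffAt ℂ n g x) (haf : ∀ k ≤ n, IsAlgebraic ℚ (iteratedDeriv k f x))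
    (hag : ∀ k ≤ n, IsAlgebraic ℚ (iteratedDeriv k g x)) :
    IsAlgebraic ℚ (iteratedDeriv n (f * g) x) := by
  rw [iteratedDeriv_mul hf hg, ← mem_algebraicClosure_iff]
  refine sum_mem fun i hi => ?_
  have hin : i ≤ n := Nat.lt_succ_iff.mp (Finset.mem_range.mp hi)
  exact mul_mem (mul_mem (natCast_mem _ _) (mem_algebraicClosure_iff.mpr (haf i hin)))
    (mem_algebraicClosure_iff.mpr (hag (n - i) (Nat.sub_le n i)))

/-- **Inverse of a unit.** If `Ψ` is analytic at `x` with `Ψ x ≠ 0` and all `Ψ⁽ᵏ⁾(x)` are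
algebraic over `ℚ`, then all derivatives of `1/Ψ` at `x` are algebraic (induction on the order
via `(1/Ψ)' = -Ψ'·(1/Ψ)·(1/Ψ)` near `x` and the Leibniz closure). [folklore] -/
theorem isAlgebraic_iteratedDeriv_inv {Ψ : ℂ → ℂ} {x : ℂ} (hΨ : AnalyticAt ℂ Ψ x) (h0 : Ψ x ≠ 0)
    (halg : ∀ k, IsAlgebraic ℚ (iteratedDeriv k Ψ x)) (k : ℕ) :
    IsAlgebraic ℚ (iteratedDeriv k (fun t => (Ψ t)⁻¹) x) := by
  set g : ℂ → ℂ := fun t => (Ψ t)⁻¹ with hg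
  have hga : AnalyticAt ℂ g x := hΨ.fun_inv h0
  suffices H : ∀ n, ∀ k ≤ n, IsAlgebraic ℚ (iteratedDeriv k g x) from H k k le_rfl
  intro n
  induction n with
  | zero =>
    intro k hk
    rw [Nat.le_zero.mp hk, iteratedDeriv_zero]
    have h := halg 0
    rw [iteratedDeriv_zero] at h
    rw [← mem_algebraicClosure_iff] at h ⊢
    exact inv_mem h
  | succ n ih =>
    intro k hk
    rcases Nat.lt_or_eq_of_le hk with hk | rfl
    · exact ih k (Nat.lt_succ_iff.mp hk)
    · rw [iteratedDeriv_succ']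
      have hev : deriv g =ᶠ[𝓝 x] fun t => -((deriv Ψ * g * g) t) := by
        filter_upwards [hΨ.eventually_analyticAt, hΨ.continuousAt.eventually_ne h0] with t hta ht0
        rw [hg, deriv_fun_inv'' hta.differentiableAt ht0, Pi.mul_apply, Pi.mul_apply]
        field_simp
      rw [hev.iteratedDeriv_eq, iteratedDeriv_fun_neg, ← mem_algebraicClosure_iff]
      refine neg_mem (mem_algebraicClosure_iff.mpr ?_)
      have hdg : ∀ j ≤ n, IsAlgebraic ℚ (iteratedDeriv j (deriv Ψ * g) x) := fun j hj =>
        isAlgebraic_iteratedDeriv_mul hΨ.deriv.contDiffAt hga.contDiffAt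
          (fun i _ => by rw [← iteratedDeriv_succ']; exact halg (i + 1))
          (fun i hi => ih i (hi.trans hj))
      exact isAlgebraic_iteratedDeriv_mul (hΨ.deriv.mul hga).contDiffAt hga.contDiffAt hdg ih

/-- **The multiplicative half of the arithmetic normal form of a cusp.** Let `ℓ` be analytic at
`0`, `e ≥ 1`, and `R ∈ ℂ[X, Y]` nonzero with algebraic coefficients such that
`R(t⁻ᵉ, e^{ℓ(t)}) = 0` on a punctured neighbourhood of `0`. Then `e^{ℓ(0)}` is algebraic over `ℚ`
and so is every `ℓ⁽ⁿ⁾(0)` with `n ≥ 1`. [folklore] -/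
theorem isAlgebraic_exp_and_iteratedDeriv_of_mvPolynomial_exp_relation (ℓ : ℂ → ℂ) (e : ℕ)
    (R : MvPolynomial (Fin 2) ℂ) (he : 0 < e) (hℓ : AnalyticAt ℂ ℓ 0) (hR : R ≠ 0)
    (halg : ∀ m, IsAlgebraic ℚ (R.coeff m))
    (h : ∀ᶠ t in 𝓝[≠] (0 : ℂ), MvPolynomial.eval ![(t ^ e)⁻¹, Complex.exp (ℓ t)] R = 0) :
    IsAlgebraic ℚ (Complex.exp (ℓ 0)) ∧ ∀ n : ℕ, 0 < n → IsAlgebraic ℚ (iteratedDeriv n ℓ 0) := by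
  set Ψ : ℂ → ℂ := fun t => Complex.exp (ℓ t) with hΨ
  have hΨa : AnalyticAt ℂ Ψ 0 := hℓ.cexp'
  have hΨrel : ∀ᶠ t in 𝓝[≠] (0 : ℂ), MvPolynomial.eval ![(t ^ e)⁻¹, Ψ t / t ^ 0] R = 0 := by
    simpa only [pow_zero, div_one] using h
  have hΨalg : ∀ n, IsAlgebraic ℚ (iteratedDeriv n Ψ 0) :=
    isAlgebraic_iteratedDeriv_of_mvPolynomial_relation Ψ e 0 R he hΨa hR halg hΨrel
  refine ⟨by simpa using hΨalg 0, fun n hn => ?_⟩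
  obtain ⟨k, rfl⟩ := Nat.exists_eq_succ_of_ne_zero hn.ne'
  have hΨ0 : Ψ 0 ≠ 0 := Complex.exp_ne_zero _
  set g : ℂ → ℂ := fun t => (Ψ t)⁻¹ with hg
  have hga : AnalyticAt ℂ g 0 := hΨa.fun_inv hΨ0
  have hgalg : ∀ j, IsAlgebraic ℚ (iteratedDeriv j g 0) :=
    isAlgebraic_iteratedDeriv_inv hΨa hΨ0 hΨalg
  -- `ℓ' = Ψ' / Ψ` near `0`
  have hev : deriv ℓ =ᶠ[𝓝 0] deriv Ψ * g := by
    filter_upwards [hℓ.eventually_analyticAt] with t ht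
    have hd : HasDerivAt Ψ (Complex.exp (ℓ t) * deriv ℓ t) t :=
      ht.differentiableAt.hasDerivAt.cexp
    rw [Pi.mul_apply, hd.deriv, hg]
    simp only [hΨ]
    field_simp [Complex.exp_ne_zero]
  rw [iteratedDeriv_succ', hev.iteratedDeriv_eq]
  exact isAlgebraic_iteratedDeriv_mul hΨa.deriv.contDiffAt hga.contDiffAt
    (fun j _ => by rw [← iteratedDeriv_succ']; exact hΨalg (j + 1)) (fun j _ => hgalg j)

end Literature.NumberTheory.Transcendental

end
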